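import Literature.Probability.Percolation.QuadCrossingSpace
import HarnessLib

/-!
# The lateral squeeze of a quad stays dominated by every strictly harder quad

Helper for crux stmt-CriticalPhenomena-10268 (`LagHandOff`, line `hitting-tournament`), registered
stub `stub_kernel_quadSqueeze_lateral` (M2): the second half of the "no-mushroom" inclusion behind
the kernel stubs (Camia–Newman 2007, Lemma 7.4, with Schramm–Smirnov continuity).

Data.  A quad `Q₀` of the plane and `0 < s`; the LATERALLY squeezed quad is any quad `Q₁` with
`Q₁ (u, t) = Q₀ (u, s + (1 - 2 s) t)` (the second coordinate read back in `[0,1]` through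
`Set.projIcc`).  Claim: if `Q₀ < Q''` in Schramm–Smirnov's order (`Quad.StrictlyDominated`), then
there is `s₀ > 0` (depending only on `Q₀`, `Q''`) such that `Q₁ ≤ Q''` (`Quad.Dominated`) for all
`0 < s < s₀` and every such `Q₁`.

Proof.  `strictlyDominated_iff` gives open sets `U₁ ∋ Q₀`, `U₂ ∋ Q''` of quads with `Q ≤ Q'''`
for all `Q ∈ U₁`, `Q''' ∈ U₂`, and `U₁ ⊇ ball Q₀ r` for some `r > 0`.  The squeeze moves each
parameter point by at most `s` (`|s + (1 - 2 s) t - t| = s |1 - 2 t| ≤ s` for `t ∈ [0,1]`, and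
`projIcc` is a contraction), so by uniform continuity of `Q₀` on the compact square,
`dist Q₁ Q₀ ≤ r / 2 < r` as soon as `s < s₀ := η`, the uniform-continuity modulus of `Q₀` for
`r / 2`.  Hence `Q₁ ∈ U₁`, and `Q'' ∈ U₂` gives `Q₁ ≤ Q''`.

References: O. Schramm, S. Smirnov, Ann. Probab. 39 (2011) 1768–1814, §1.3 (the orders `≤`, `<`
on quads) [SchrammSmirnov2011]; F. Camia, C. M. Newman, Probab. Theory Related Fields 139 (2007),
Lemma 7.4 [CamiaNewman2007].
-/

noncomputable section

open Set Metric
open scoped Topology unitInterval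
open Literature.Probability.Percolation Literature.Probability.Percolation.QuadCrossing

namespace Summit.CriticalPhenomena.CardyFormulaZ2.Cruxes.LagHandOff.HittingTournament

/-- The lateral squeeze `t ↦ s + (1 - 2 s) t`, read back in `[0,1]` through `projIcc`, moves each
point of `[0,1]` by at most `s` (for `0 ≤ s`): `|s + (1 - 2 s) t - t| = s |1 - 2 t| ≤ s`, and
`projIcc` is a contraction. [folklore] -/
theorem dist_projIcc_lateralSqueeze_le {s : ℝ} (hs : 0 ≤ s) (t : I) :
    dist (Set.projIcc (0 : ℝ) 1 zero_le_one (s + (1 - 2 * s) * (t : ℝ))) t ≤ s := by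
  have ht : (t : ℝ) ∈ Icc (0 : ℝ) 1 := t.2
  have key : |s + (1 - 2 * s) * (t : ℝ) - (t : ℝ)| ≤ s := by
    rw [show s + (1 - 2 * s) * (t : ℝ) - (t : ℝ) = s * (1 - 2 * (t : ℝ)) by ring, abs_mul,
      abs_of_nonneg hs]
    have h2 : |1 - 2 * (t : ℝ)| ≤ 1 := abs_le.2 ⟨by linarith [ht.2], by linarith [ht.1]⟩
    calc s * |1 - 2 * (t : ℝ)| ≤ s * 1 := mul_le_mul_of_nonneg_left h2 hs
      _ = s := mul_one s
  calc dist (Set.projIcc (0 : ℝ) 1 zero_le_one (s + (1 - 2 * s) * (t : ℝ))) t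
      = dist (Set.projIcc (0 : ℝ) 1 zero_le_one (s + (1 - 2 * s) * (t : ℝ)))
          (Set.projIcc (0 : ℝ) 1 zero_le_one (t : ℝ)) := by rw [Set.projIcc_val zero_le_one t]
    _ ≤ |s + (1 - 2 * s) * (t : ℝ) - (t : ℝ)| := by
        rw [Subtype.dist_eq, Real.dist_eq]
        exact Set.abs_projIcc_sub_projIcc zero_le_one
    _ ≤ s := key

/-- A laterally squeezed quad is uniformly close to the original: if
`Q₁ (u, t) = Q₀ (u, s + (1 - 2 s) t)` with `0 ≤ s < η`, where `Q₀` moves by less than `ε` over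
parameter distances `< η`, then `dist Q₁ Q₀ ≤ ε`. [folklore] -/
theorem dist_lateralSqueeze_le {Q₀ Q₁ : Quad (Set.univ : Set ℂ)} {s η ε : ℝ} (hs : 0 ≤ s)
    (hsη : s < η) (hε : 0 ≤ ε)
    (hη : ∀ a b : I × I, dist a b < η → dist (Q₀ a) (Q₀ b) < ε)
    (hQ₁ : ∀ p : I × I,
      Q₁ p = Q₀ (p.1, Set.projIcc (0 : ℝ) 1 zero_le_one (s + (1 - 2 * s) * (p.2 : ℝ)))) :
    dist Q₁ Q₀ ≤ ε := by
  rw [Quad.dist_eq, ContinuousMap.dist_le hε]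
  intro p
  show dist (Q₁ p) (Q₀ p) ≤ ε
  rw [hQ₁ p]
  refine (hη _ _ ?_).le
  rw [Prod.dist_eq]
  refine max_lt ?_ ?_
  · show dist p.1 p.1 < η
    rw [dist_self]
    exact hs.trans_lt hsη
  · show dist (Set.projIcc (0 : ℝ) 1 zero_le_one (s + (1 - 2 * s) * (p.2 : ℝ))) p.2 < η
    exact (dist_projIcc_lateralSqueeze_le hs p.2).trans_lt hsη

/-- **M2: the lateral squeeze stays below every strictly harder quad.**  If `Q₀ < Q''`
(`Quad.StrictlyDominated`), there is `s₀ > 0` such that for `0 < s < s₀` every quad `Q₁` with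
`Q₁ (u, t) = Q₀ (u, s + (1 - 2 s) t)` satisfies `Q₁ ≤ Q''` (`Quad.Dominated`): the witnessing
neighbourhood `U₁ ∋ Q₀` of `Q₀ < Q''` contains a ball around `Q₀`, and `Q₁ → Q₀` uniformly as
`s → 0` by uniform continuity of `Q₀` on the compact square.
[cite: SchrammSmirnov2011, §1.3] -/
theorem stub_kernel_quadSqueeze_lateral :
    ∀ (Q₀ Q'' : Quad (Set.univ : Set ℂ)), Quad.StrictlyDominated Q₀ Q'' →
      ∃ s₀ : ℝ, 0 < s₀ ∧ ∀ s : ℝ, 0 < s → s < s₀ → ∀ Q₁ : Quad (Set.univ : Set ℂ),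
        (∀ p : I × I,
          Q₁ p = Q₀ (p.1, Set.projIcc (0 : ℝ) 1 zero_le_one (s + (1 - 2 * s) * (p.2 : ℝ)))) →
        Quad.Dominated Q₁ Q'' := by
  intro Q₀ Q'' hlt
  obtain ⟨U₁, U₂, hU₁, -, h₁, h₂, hdom⟩ := Quad.strictlyDominated_iff.1 hlt
  obtain ⟨r, hr, hball⟩ := Metric.isOpen_iff.1 hU₁ Q₀ h₁
  have huc : UniformContinuous (Q₀ : I × I → ℂ) :=
    CompactSpace.uniformContinuous_of_continuous Q₀.continuous_toFun
  obtain ⟨η, hη, hQη⟩ := Metric.uniformContinuous_iff.1 huc (r / 2) (half_pos hr)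
  refine ⟨η, hη, fun s hs hsη Q₁ hQ₁ => hdom Q₁ (hball ?_) Q'' h₂⟩
  rw [Metric.mem_ball]
  exact (dist_lateralSqueeze_le hs.le hsη (half_pos hr).le (fun a b h => hQη h) hQ₁).trans_lt
    (half_lt_self hr)

end Summit.CriticalPhenomena.CardyFormulaZ2.Cruxes.LagHandOff.HittingTournament

end
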